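import Mathlib
import Summits.NavierStokesRegularity.FluidComputer.GalerkinEmergenceLimit
import Summits.NavierStokesRegularity.FluidComputer.BoundedGeneratorEmergence

/-!
# KEEP and KILL for the TRUE trajectory: Galerkin-level certificates + `C⁰`-convergence (instab g15, cell `ns-blowup`, 2026-08-26)

HONEST FRAMING (human ruling D-0035): nothing here is a claim about Navier–Stokes blow-up.
WHAT THIS IS NOT: not NS evidence. This file composes the Galerkin-level theorems of g14
(`BoundedGeneratorEmergence`: (M) and (T) DISCHARGED for a bounded generator, R-β and its KILL
twin modulo (B)) with the closure / slack / consistency lemmas of `GalerkinEmergenceLimit` (g15)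
inside the tree's Wilczak–Zgliczyński engine `Literature.Analysis.ODE.GalerkinConvergenceSetting`
(`GalerkinLimit.lean`, [WilczakZgliczynski2025, Thm. 11]). Result: the KEEP word (amplitude floor
`ε e^{λt}/2` up to the clock) and the KILL word (`‖u t‖ ≤ 2 ε e^{λt}` inside the basin) hold for
EVERY CLASSICAL SOLUTION OF THE FULL (untruncated) SYSTEM `w' = F (w)` that stays in the compact
set `W` of self-consistent bounds — with NO semigroup theory for the unbounded linearised operator.
What is assumed, level by level (`n` = truncation level, `P n` the Galerkin projection):

* the setting `GalerkinConvergenceSetting P F W Z T l u` (S: `W` compact, `P n W ⊆ W`; C1: `F`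
  continuous on `W`; C2: ONE one-sided Lipschitz constant `l` for all levels — supplied by a
  Lyapunov certificate, g14 `GalerkinOneSidedLipschitz.galerkin_oneSided_uniform`; Galerkin
  solutions `u n x` on `[0, T]` staying in `W`);
* the Galerkin structure of the field on `W`: `P n (F w) = A_n w + B_n (w, w)` for `w ∈ W ∩ range P n`,
  with bounded level generators `A_n : E →L[ℝ] E` and level nonlinearities `B_n`;
* the CERTIFICATES, stated on each `A_n` with level-INDEPENDENT scalars (this is what a head∣tail
  certificate is): the two-level pair (3-L′: `ω, c, m₂, M₁`, weights `G₁ⁿ, G₂ⁿ, D₁ⁿ`) and the strong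
  pair (3-L: `m, M, ω₁`, weight `Gⁿ`); the bilinear loss (B) for each `B_n` with one `c_alg`;
* for KEEP: a normalised vector `v` and a rate `λ ≥ 0`, `2λ > ω`, on which the truncations are
  CONSISTENT, `‖A_n (P_n v) − λ P_n v‖ → 0` (for a true eigenvector `A v = λ v` of the untruncated
  operator and Fourier truncations this residual is `‖P_n A (1 − P_n) v‖ → 0`).

Theorems: `half_prediction_of_classical_slack` (level form with an abstract slack, (M)(T)
discharged), `half_prediction_of_galerkin_limit` (KEEP for the true trajectory: for every `C' > C`,
`C = √(M₁/(c m₂))·c_alg·√(π/(2λ − ω))`, satisfying the window condition, `‖w t‖ ≥ ε e^{λt}/2`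
wherever `ε e^{λt} ≤ 2/(9C')`), `decay_two_of_galerkin_limit` (KILL for the true trajectory: every
seed `x ∈ Z` with `√(M/m)‖x‖ < ε`, `4Cε < 1` gives `‖w t‖ ≤ 2ε e^{λt}` on `[0, T]`). The remaining
named inputs toward the forced-ABC linearisation are model-specific: the compact `W` with decaying
Fourier tails on which `ℙ[(u·∇)u]` is Lipschitz in the certificate norm (INSTAB-BRIDGE l.130 (d)
(β)) and the certificates themselves. Mathlib + the two cited tree files; no new definitions.
-/

noncomputable section

namespace Summit.NavierStokesRegularity.FluidComputer.GalerkinEmergenceTrue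

open Set Filter Topology MeasureTheory intervalIntegral NormedSpace RCLike
open scoped InnerProductSpace
open Summit.NavierStokesRegularity.FluidComputer.EmergenceMildDuhamel
open Summit.NavierStokesRegularity.FluidComputer.StabilityMildDuhamel
open Summit.NavierStokesRegularity.FluidComputer.BoundedGeneratorDuhamel
open Summit.NavierStokesRegularity.FluidComputer.BoundedGeneratorEmergence
open Summit.NavierStokesRegularity.FluidComputer.GalerkinEmergenceLimit
open Literature.Analysis.ODE

variable {𝕜 E : Type*} [RCLike 𝕜] [NormedAddCommGroup E] [InnerProductSpace 𝕜 E]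
  [NormedSpace ℝ E] [CompleteSpace E]

/-! ### The level form: R-β for a bounded generator from an arbitrary seed, with slack -/

omit [CompleteSpace E] in
/-- **The `a₀` of the slack floor in the unstable case:** for `λ ≥ 0`, `ε ≥ 0` and `t ≥ 0`,
`ε ≤ ε e^{λt}`. -/
theorem le_prediction_of_nonneg_rate {ε lam t : ℝ} (hε : 0 ≤ ε) (hlam : 0 ≤ lam) (ht : 0 ≤ t) :
    ε ≤ ε * Real.exp (lam * t) := by
  have h : 1 ≤ Real.exp (lam * t) := Real.one_le_exp (by positivity)
  nlinarith

/-- **R-β FOR A BOUNDED GENERATOR FROM AN ARBITRARY SEED (level-`n` form, slack abstract).** Let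
`A : E →L[ℝ] E` carry the two-level certificate of
`BoundedGeneratorEmergence.norm_linearFlow_le_of_two_level` (constants `ω, c, m₂, M₁`, reference
weight `D₁`; `S = √(M₁/(c m₂))`), let `B` satisfy (B) with constant `c_alg`, let `2λ > ω`, `λ ≥ 0`,
`ε > 0`, and let `u` be a classical solution of `u' = A u + B(u,u)` on `[0, T₀]` whose linear
prediction is `ε e^{λt}` UP TO A SLACK: `|‖e^{tA}(u 0)‖ − ε e^{λt}| ≤ η` on the window (for
`u 0 = ε y`, `GalerkinEmergenceLimit.linear_prediction_slack`). If `C'` absorbs the slack,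
`C ((3/2) ε)² + η ≤ C' ((3/2) ε)²` with `C = S·c_alg·√(π/(2λ − ω))`, and the window condition
`C' (3/2)² ε e^{λt} < 1/2` holds on `[0, T₀]`, then `‖u t‖ ≥ ε e^{λt}/2` at every `t ∈ [0, T₀]` with
`ε e^{λt} ≤ 2/(9C')`. (M) and (T) are DISCHARGED; (B) and the slack are hypotheses. -/
theorem half_prediction_of_classical_slack (A : E →L[ℝ] E) (B : E → E → E)
    {G₁ G₂ D₁ : E →L[ℝ] E}
    (hG₁ : ∀ x y : E, ⟪G₁ x, y⟫_𝕜 = ⟪x, G₁ y⟫_𝕜) (hG₂ : ∀ x y : E, ⟪G₂ x, y⟫_𝕜 = ⟪x, G₂ y⟫_𝕜)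
    (hG₁pos : ∀ x : E, 0 ≤ re ⟪G₁ x, x⟫_𝕜) {ω c m₂ M₁ : ℝ} (hc : 0 < c) (hm₂ : 0 < m₂)
    (hM₁ : 0 ≤ M₁) (hm₂' : ∀ x : E, m₂ * ‖x‖ ^ 2 ≤ re ⟪G₂ x, x⟫_𝕜)
    (hD₁ : ∀ x : E, 0 ≤ re ⟪D₁ x, x⟫_𝕜) (hM₁' : ∀ x : E, re ⟪G₁ x, x⟫_𝕜 ≤ M₁ * re ⟪D₁ x, x⟫_𝕜)
    (h₁ : ∀ w : E, 2 * re ⟪G₁ w, A w⟫_𝕜 + c * re ⟪G₂ w, w⟫_𝕜 ≤ 2 * ω * re ⟪G₁ w, w⟫_𝕜)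
    (h₂ : ∀ w : E, re ⟪G₂ w, A w⟫_𝕜 ≤ ω * re ⟪G₂ w, w⟫_𝕜)
    {lam ε : ℝ} (hgap : ω < 2 * lam) (hlam : 0 ≤ lam) (hε : 0 < ε)
    {calg : ℝ} (hcalg : 0 ≤ calg)
    (hB : ∀ x y : E, Real.sqrt (re ⟪D₁ (B x y), B x y⟫_𝕜) ≤ calg * ‖x‖ * ‖y‖)
    {u : ℝ → E} {T₀ : ℝ} (hu : ContinuousOn u (Icc 0 T₀))
    (hBu : ContinuousOn (fun s => B (u s) (u s)) (Icc 0 T₀))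
    (hderiv : ∀ s ∈ Ioo 0 T₀, HasDerivAt u (A (u s) + B (u s) (u s)) s)
    {η C' : ℝ}
    (hslack : ∀ t ∈ Icc 0 T₀, |‖exp (t • A) (u 0)‖ - ε * Real.exp (lam * t)| ≤ η)
    (hC' : Real.sqrt (M₁ / (c * m₂)) * calg * Real.sqrt (Real.pi / (2 * lam - ω)) *
        ((3 / 2 : ℝ) * ε) ^ 2 + η ≤ C' * ((3 / 2 : ℝ) * ε) ^ 2)
    (hsmall : ∀ t ∈ Icc 0 T₀, C' * (3 / 2 : ℝ) ^ 2 * (ε * Real.exp (lam * t)) < 3 / 2 - 1)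
    {t : ℝ} (ht : t ∈ Icc 0 T₀) (hχ : ε * Real.exp (lam * t) ≤ 2 / (9 * C')) :
    ε * Real.exp (lam * t) / 2 ≤ ‖u t‖ := by
  have hS : 0 ≤ Real.sqrt (M₁ / (c * m₂)) := Real.sqrt_nonneg _
  have hT := smoothing_bound_linearFlow A hG₁ hG₂ hG₁pos hc hm₂ hM₁ hm₂' hD₁ hM₁' h₁ h₂
  have hmild := mild_formula_of_classical A (fun x => B x x) hu hBu hderiv
  have ha : ∀ s ∈ Icc 0 T₀, ε ≤ ε * Real.exp (lam * s) := fun s hs =>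
    le_prediction_of_nonneg_rate hε.le hlam hs.1
  exact half_prediction_of_mild_slack (p := fun x => Real.sqrt (re ⟪D₁ x, x⟫_𝕜))
    (T := fun τ x => exp (τ • A) x) (B := B) (u := u) (ℓ := fun t => exp (t • A) (u 0))
    hS hcalg hgap hε hε hT hB hu hmild hslack ha hC' hsmall ht hχ

/-! ### The true trajectory: composition inside `GalerkinConvergenceSetting` -/

section True

variable {P : ℕ → E →L[ℝ] E} {F : E → E} {W Z : Set E} {T l : ℝ} {u : ℕ → E → ℝ → E}

omit [InnerProductSpace 𝕜 E] [CompleteSpace E] in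
/-- **The Galerkin solutions are classical solutions of the level system.** If on `W ∩ range P n`
the truncated field reads `P n (F w) = A_n w + B_n (w, w)`, then the level-`n` Galerkin solution
from `x ∈ Z` solves `u' = A_n u + B_n (u, u)` at every interior time, and `s ↦ B_n (u s, u s)` is
continuous on `[0, T]` (it equals `P_n F (u s) − A_n (u s)` there). -/
theorem galerkin_level_classical (h : GalerkinConvergenceSetting P F W Z T l u)
    (An : ℕ → E →L[ℝ] E) (Bn : ℕ → E → E → E)
    (hfield : ∀ n, ∀ w ∈ W, P n w = w → P n (F w) = An n w + Bn n w w)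
    (n : ℕ) {x : E} (hx : x ∈ Z) :
    (∀ s ∈ Ioo 0 T, HasDerivAt (u n x) (An n (u n x s) + Bn n (u n x s) (u n x s)) s) ∧
      ContinuousOn (fun s => Bn n (u n x s) (u n x s)) (Icc 0 T) := by
  have hid : ∀ s ∈ Icc 0 T, P n (F (u n x s)) = An n (u n x s) + Bn n (u n x s) (u n x s) :=
    fun s hs => hfield n (u n x s) (h.sol_mem n x hx s hs) (h.sol_proj n x hx s hs)
  refine ⟨fun s hs => (h.sol_hasDerivAt n x hx s hs).congr_deriv (hid s (Ioo_subset_Icc_self hs)),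
    ?_⟩
  have hPF : ContinuousOn (fun s => P n (F (u n x s))) (Icc 0 T) :=
    (P n).continuous.comp_continuousOn
      (h.continuousOn.comp (h.sol_continuousOn n x hx) fun s hs => h.sol_mem n x hx s hs)
  have hA : ContinuousOn (fun s => An n (u n x s)) (Icc 0 T) :=
    (An n).continuous.comp_continuousOn (h.sol_continuousOn n x hx)
  refine (hPF.sub hA).congr fun s hs => ?_
  show Bn n (u n x s) (u n x s) = P n (F (u n x s)) - An n (u n x s)
  rw [hid s hs]; abel

/-- **KEEP FOR THE TRUE TRAJECTORY (R-β via Galerkin convergence, no semigroup theory).** In a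
`GalerkinConvergenceSetting P F W Z T l u` on a complete inner-product space, suppose the truncated
field has the Galerkin structure `P n (F w) = A_n w + B_n (w, w)` on `W ∩ range P n`, every level
generator `A_n` carries the two-level certificate (scalars `ω, c, m₂, M₁`, weights `G₁ⁿ, G₂ⁿ, D₁ⁿ`)
and the strong certificate (scalars `m, M, ω₁`, weight `Gⁿ`) with level-INDEPENDENT scalars, every
`B_n` satisfies (B) with one constant `c_alg`, and the truncations are consistent on a normalised
vector `v` at a rate `λ ≥ 0` with `2λ > ω`: `‖A_n (P_n v) − λ P_n v‖ → 0`. Put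
`C = √(M₁/(c m₂))·c_alg·√(π/(2λ − ω))` and let `C' > C` satisfy the window condition
`C' (3/2)² ε e^{λt} < 1/2` on `[0, T]` (`ε > 0`, `ε v ∈ Z`). Then EVERY classical solution `w` of the
full system `w' = F (w)` on `(0, T)`, continuous on `[0, T]`, with `w 0 = ε v`, staying in `W`,
satisfies `‖w t‖ ≥ ε e^{λt}/2` at every `t ∈ [0, T]` with `ε e^{λt} ≤ 2/(9C')` — the amplitude floor
and the clock of R-β for the TRUE trajectory. -/
theorem half_prediction_of_galerkin_limit (h : GalerkinConvergenceSetting P F W Z T l u)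
    (An : ℕ → E →L[ℝ] E) (Bn : ℕ → E → E → E)
    (hfield : ∀ n, ∀ w ∈ W, P n w = w → P n (F w) = An n w + Bn n w w)
    {G₁ G₂ D₁ : ℕ → E →L[ℝ] E}
    (hG₁ : ∀ n, ∀ x y : E, ⟪G₁ n x, y⟫_𝕜 = ⟪x, G₁ n y⟫_𝕜)
    (hG₂ : ∀ n, ∀ x y : E, ⟪G₂ n x, y⟫_𝕜 = ⟪x, G₂ n y⟫_𝕜)
    (hG₁pos : ∀ n, ∀ x : E, 0 ≤ re ⟪G₁ n x, x⟫_𝕜) {ω c m₂ M₁ : ℝ} (hc : 0 < c) (hm₂ : 0 < m₂)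
    (hM₁ : 0 ≤ M₁) (hm₂' : ∀ n, ∀ x : E, m₂ * ‖x‖ ^ 2 ≤ re ⟪G₂ n x, x⟫_𝕜)
    (hD₁ : ∀ n, ∀ x : E, 0 ≤ re ⟪D₁ n x, x⟫_𝕜)
    (hM₁' : ∀ n, ∀ x : E, re ⟪G₁ n x, x⟫_𝕜 ≤ M₁ * re ⟪D₁ n x, x⟫_𝕜)
    (h₁ : ∀ n, ∀ w : E,
      2 * re ⟪G₁ n w, An n w⟫_𝕜 + c * re ⟪G₂ n w, w⟫_𝕜 ≤ 2 * ω * re ⟪G₁ n w, w⟫_𝕜)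
    (h₂ : ∀ n, ∀ w : E, re ⟪G₂ n w, An n w⟫_𝕜 ≤ ω * re ⟪G₂ n w, w⟫_𝕜)
    {G : ℕ → E →L[ℝ] E} (hG : ∀ n, ∀ x y : E, ⟪G n x, y⟫_𝕜 = ⟪x, G n y⟫_𝕜) {m M ω₁ : ℝ}
    (hm0 : 0 < m) (hm : ∀ n, ∀ x : E, m * ‖x‖ ^ 2 ≤ re ⟪G n x, x⟫_𝕜)
    (hM : ∀ n, ∀ x : E, re ⟪G n x, x⟫_𝕜 ≤ M * ‖x‖ ^ 2)
    (hL : ∀ n, ∀ w : E, re ⟪G n w, An n w⟫_𝕜 ≤ ω₁ * re ⟪G n w, w⟫_𝕜)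
    {calg : ℝ} (hcalg : 0 ≤ calg)
    (hB : ∀ n, ∀ x y : E, Real.sqrt (re ⟪D₁ n (Bn n x y), Bn n x y⟫_𝕜) ≤ calg * ‖x‖ * ‖y‖)
    {v : E} (hv1 : ‖v‖ = 1) {lam ε : ℝ} (hgap : ω < 2 * lam) (hlam : 0 ≤ lam) (hε : 0 < ε)
    (hx : ε • v ∈ Z)
    (hres : Tendsto (fun n => ‖An n (P n v) - lam • P n v‖) atTop (𝓝 0))
    {C' : ℝ}
    (hCC' : Real.sqrt (M₁ / (c * m₂)) * calg * Real.sqrt (Real.pi / (2 * lam - ω)) < C')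
    (hsmall : ∀ t ∈ Icc 0 T, C' * (3 / 2 : ℝ) ^ 2 * (ε * Real.exp (lam * t)) < 3 / 2 - 1)
    {w : ℝ → E} (hw : ContinuousOn w (Icc 0 T)) (hw0 : w 0 = ε • v)
    (hw' : ∀ t ∈ Ioo 0 T, HasDerivAt w (F (w t)) t) (hwW : ∀ t ∈ Icc 0 T, w t ∈ W)
    {t : ℝ} (ht : t ∈ Icc 0 T) (hχ : ε * Real.exp (lam * t) ≤ 2 / (9 * C')) :
    ε * Real.exp (lam * t) / 2 ≤ ‖w t‖ := by
  have hT0 : 0 ≤ T := ht.1.trans ht.2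
  set C : ℝ := Real.sqrt (M₁ / (c * m₂)) * calg * Real.sqrt (Real.pi / (2 * lam - ω)) with hC
  set MG : ℝ := Real.sqrt (M / m) with hMG
  have hMG0 : 0 ≤ MG := Real.sqrt_nonneg _
  -- the slack of level n
  set η : ℕ → ℝ := fun n => ε * (MG * Real.exp ((|ω₁| + |lam|) * T) * T *
    ‖An n (P n v) - lam • P n v‖ + Real.exp (|lam| * T) * |‖P n v‖ - 1|) with hη
  have hη0 : Tendsto η atTop (𝓝 0) := by
    have h1 : Tendsto (fun n => |‖P n v‖ - 1|) atTop (𝓝 0) := by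
      have : Tendsto (fun n => ‖P n v‖ - 1) atTop (𝓝 (‖v‖ - 1)) :=
        (h.tendsto_proj v).norm.sub_const 1
      rw [hv1, sub_self] at this
      simpa using this.abs
    have h2 : Tendsto (fun n => MG * Real.exp ((|ω₁| + |lam|) * T) * T *
        ‖An n (P n v) - lam • P n v‖ + Real.exp (|lam| * T) * |‖P n v‖ - 1|) atTop (𝓝 0) := by
      simpa using (hres.const_mul (MG * Real.exp ((|ω₁| + |lam|) * T) * T)).add
        (h1.const_mul (Real.exp (|lam| * T)))
    simpa [hη] using h2.const_mul ε
  -- eventually the slack is absorbed by the margin C' − C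
  have hδ : 0 < (C' - C) * ((3 / 2 : ℝ) * ε) ^ 2 := by
    have : 0 < C' - C := sub_pos.2 hCC'
    positivity
  have hev : ∀ᶠ n in atTop, η n < (C' - C) * ((3 / 2 : ℝ) * ε) ^ 2 := hη0.eventually_lt_const hδ
  -- the level-n half prediction for all large n
  have hlevel : ∀ᶠ n in atTop, ε * Real.exp (lam * t) / 2 ≤ ‖u n (ε • v) t‖ := by
    filter_upwards [hev] with n hn
    obtain ⟨hderiv, hBu⟩ := galerkin_level_classical h An Bn hfield n hx
    have hflow := norm_linearFlow_le_of_generator_form (𝕜 := 𝕜) (An n) (hG n) hm0 (hm n) (hM n)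
      (hL n)
    have hu0 : u n (ε • v) 0 = ε • P n v := by rw [h.sol_init n _ hx, map_smul]
    have hslack : ∀ s ∈ Icc 0 T,
        |‖exp (s • An n) (u n (ε • v) 0)‖ - ε * Real.exp (lam * s)| ≤ η n := by
      intro s hs
      rw [hu0]
      exact linear_prediction_slack (An n) hMG0 hflow (P n v) hε.le hs
    have hC' : C * ((3 / 2 : ℝ) * ε) ^ 2 + η n ≤ C' * ((3 / 2 : ℝ) * ε) ^ 2 := by nlinarith
    exact half_prediction_of_classical_slack (𝕜 := 𝕜) (An n) (Bn n) (hG₁ n) (hG₂ n) (hG₁pos n)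
      hc hm₂ hM₁ (hm₂' n) (hD₁ n) (hM₁' n) (h₁ n) (h₂ n) hgap hlam hε hcalg (hB n)
      (h.sol_continuousOn n _ hx) hBu hderiv hslack hC' hsmall ht hχ
  exact solution_norm_ge h hx hw hw0 hw' hwW ht tendsto_const_nhds hlevel

/-- **KILL FOR THE TRUE TRAJECTORY (basin radius and decay via Galerkin convergence).** In the
setting of `half_prediction_of_galerkin_limit` (Galerkin structure of the field, two-level and
strong certificates with level-independent scalars, (B) with one `c_alg`), suppose the two-level
pair is NEGATIVE enough for a decay rate: `ω < 2λ ≤ 0`, and the strong abscissa satisfies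
`ω₁ ≤ λ`. Put `C = √(M₁/(c m₂))·c_alg·√(π/(2λ − ω))`. Then for every seed `x ∈ Z` and every
`ε > 0` with `√(M/m)·‖x‖ < ε` and `4Cε < 1` (the BASIN RADIUS), EVERY classical solution `w` of the
full system `w' = F (w)` on `(0, T)`, continuous on `[0, T]`, with `w 0 = x`, staying in `W`,
obeys `‖w t‖ ≤ 2 ε e^{λt}` at every `t ∈ [0, T]`. -/
theorem decay_two_of_galerkin_limit (h : GalerkinConvergenceSetting P F W Z T l u)
    (An : ℕ → E →L[ℝ] E) (Bn : ℕ → E → E → E)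
    (hfield : ∀ n, ∀ w ∈ W, P n w = w → P n (F w) = An n w + Bn n w w)
    {G₁ G₂ D₁ : ℕ → E →L[ℝ] E}
    (hG₁ : ∀ n, ∀ x y : E, ⟪G₁ n x, y⟫_𝕜 = ⟪x, G₁ n y⟫_𝕜)
    (hG₂ : ∀ n, ∀ x y : E, ⟪G₂ n x, y⟫_𝕜 = ⟪x, G₂ n y⟫_𝕜)
    (hG₁pos : ∀ n, ∀ x : E, 0 ≤ re ⟪G₁ n x, x⟫_𝕜) {ω c m₂ M₁ : ℝ} (hc : 0 < c) (hm₂ : 0 < m₂)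
    (hM₁ : 0 ≤ M₁) (hm₂' : ∀ n, ∀ x : E, m₂ * ‖x‖ ^ 2 ≤ re ⟪G₂ n x, x⟫_𝕜)
    (hD₁ : ∀ n, ∀ x : E, 0 ≤ re ⟪D₁ n x, x⟫_𝕜)
    (hM₁' : ∀ n, ∀ x : E, re ⟪G₁ n x, x⟫_𝕜 ≤ M₁ * re ⟪D₁ n x, x⟫_𝕜)
    (h₁ : ∀ n, ∀ w : E,
      2 * re ⟪G₁ n w, An n w⟫_𝕜 + c * re ⟪G₂ n w, w⟫_𝕜 ≤ 2 * ω * re ⟪G₁ n w, w⟫_𝕜)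
    (h₂ : ∀ n, ∀ w : E, re ⟪G₂ n w, An n w⟫_𝕜 ≤ ω * re ⟪G₂ n w, w⟫_𝕜)
    {G : ℕ → E →L[ℝ] E} (hG : ∀ n, ∀ x y : E, ⟪G n x, y⟫_𝕜 = ⟪x, G n y⟫_𝕜) {m M ω₁ : ℝ}
    (hm0 : 0 < m) (hm : ∀ n, ∀ x : E, m * ‖x‖ ^ 2 ≤ re ⟪G n x, x⟫_𝕜)
    (hM : ∀ n, ∀ x : E, re ⟪G n x, x⟫_𝕜 ≤ M * ‖x‖ ^ 2)
    (hL : ∀ n, ∀ w : E, re ⟪G n w, An n w⟫_𝕜 ≤ ω₁ * re ⟪G n w, w⟫_𝕜)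
    {lam : ℝ} (hgap : ω < 2 * lam) (hlam : lam ≤ 0) (hrate : ω₁ ≤ lam)
    {calg : ℝ} (hcalg : 0 ≤ calg)
    (hB : ∀ n, ∀ x y : E, Real.sqrt (re ⟪D₁ n (Bn n x y), Bn n x y⟫_𝕜) ≤ calg * ‖x‖ * ‖y‖)
    {x : E} (hx : x ∈ Z) {ε : ℝ} (hε : 0 < ε) (hseed : Real.sqrt (M / m) * ‖x‖ < ε)
    (hbasin : 4 * (Real.sqrt (M₁ / (c * m₂)) * calg * Real.sqrt (Real.pi / (2 * lam - ω))) * ε < 1)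
    {w : ℝ → E} (hw : ContinuousOn w (Icc 0 T)) (hw0 : w 0 = x)
    (hw' : ∀ t ∈ Ioo 0 T, HasDerivAt w (F (w t)) t) (hwW : ∀ t ∈ Icc 0 T, w t ∈ W) :
    ∀ t ∈ Icc 0 T, ‖w t‖ ≤ 2 * (ε * Real.exp (lam * t)) := by
  intro t ht
  -- eventually the projected seed is inside the basin slice `√(M/m)‖P n x‖ ≤ ε`
  have hPx : Tendsto (fun n => Real.sqrt (M / m) * ‖P n x‖) atTop (𝓝 (Real.sqrt (M / m) * ‖x‖)) :=
    ((h.tendsto_proj x).norm).const_mul _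
  have hev : ∀ᶠ n in atTop, Real.sqrt (M / m) * ‖P n x‖ < ε := hPx.eventually_lt_const hseed
  have hlevel : ∀ᶠ n in atTop, ‖u n x t‖ ≤ 2 * (ε * Real.exp (lam * t)) := by
    filter_upwards [hev] with n hn
    obtain ⟨hderiv, hBu⟩ := galerkin_level_classical h An Bn hfield n hx
    have hseed' : Real.sqrt (M / m) * ‖u n x 0‖ ≤ ε := by rw [h.sol_init n x hx]; exact hn.le
    exact decay_two_of_classical (𝕜 := 𝕜) (An n) (Bn n) (hG₁ n) (hG₂ n) (hG₁pos n) hc hm₂ hM₁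
      (hm₂' n) (hD₁ n) (hM₁' n) (h₁ n) (h₂ n) (hG n) hm0 (hm n) (hM n) (hL n) hgap hlam hrate
      hcalg (hB n) (h.sol_continuousOn n x hx) hBu hderiv hε hseed' hbasin t ht
  exact solution_norm_le h hx hw hw0 hw' hwW ht tendsto_const_nhds hlevel

end True

end Summit.NavierStokesRegularity.FluidComputer.GalerkinEmergenceTrue

end
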